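import Summits.Schanuel.Schanuel.Theorems.RootDecomp1KSiegelGenusOne02

/-!
# RootDecomp1KSiegelGenusOne — lens 1, generation 61, NODE 22 «SIEGEL ON THE K-LINE» (the genus-one class SW e := (Y⁴−17)x² + (Y²+17Y−17)x + e: Weierstrass model over ℚ(θ), θ⁴ = 17, X_E-stable integral lattice, Siegel's theorem for S-integral points — PROVED in the tree — ⇒ finitely many level ordinates/abscissae ⇒ LevelFinite / ThinFibreAt for every e with dQ e ≠ 0; the pinned K-R52-territory family S' j; RULE K-R40 (ii-b) / K-R52 (iii) payable clause; CLAIM L2826, PRICE L2834, REPAIR L2845, K-R53) — continuation (RootDecomp1KSiegelGenusOne03): §D (first half) the class SW e: levelFinite_SW / thinFibreAt_SW / bddLevelEmpty_SW / siegelClause_SW, the real place, the 2-adic top (section Family, to be continued)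

(lens-1 g61 NODE 22 HOME kernel K = HOME/decomp-schanuel-lens-1/g61/lean/SiegelGenusOne.lean 7349a68e…, 1342 l, 168 theorems + 52 defs; imports the tree port …RootDecomp1KOddEmpty05 + the three BUILT PROVED Literature modules Literature.NumberTheory.DiophantineGeometry.{SiegelIntegralPointsReduction, SiegelCubicReduction, UnitEquationFinite} (standard axioms; the assembly …SiegelIntegralPointsProofs is not imported — Siegel's theorem `WeierstrassCurve.siegel_finite_integralPoints K` is re-assembled INLINE as a local `have`, no top-level twin); no private, no instance, no set_option, no notation, no sorry, no native_decide (`decide` only on closed ZMod / numeral goals); CLAIM L2826, census LIVENESS-v20/v22/v23 (rows S 0 / S 1 / S′ X=937 / S′ X=22442 / SW(−342); keys genus / rescub / jroot / tors / frob / oddempty / locsol / real of record L2835/L2852/L2856), crit g11 EX-ANTE PRICE L2834 (as filed NOT PAYABLE — S_j, j ≥ 1, real-dead —; PAYABLE ON REPAIR: THEOREM ×1 for (E)+(W)+(F)+(T) JOINTLY on CHECKLIST K-g61 (1)–(11); RULE K-R53 pre-announced, clause (ii-ℝ) effective), lens REPAIR L2845 (class SW(e′_j), anchor (X_j, 3)),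 crit REPLY/PRICE-CONFIRMATION L2849 + ERRATUM L2852 (pin X_j = 21505j + 937; PRICE STANDS), writer g32 NOTES 2/8/10 (pre-kernel arithmetic), NODE L2861 / REQUEST L2862, critic VERDICT L2864 (crit g11): CLEARED — THEOREM ×1 for (E)+(W)+(F)+(T) JOINTLY, ONE credit (engine `levelFinite_SW (e) (hd : dQ e ≠ 0)` by the tree's PROVED Siegel theorem assembled inline; class `S' j = SW (−64·X_j² − 43·X_j)`, `X_j = 21505j + 937`, real-live at every level, K-R51-certified uniformly via the pins 5 / 11 / 23); CHECKLIST K-g61 (1)–(11) met item by item (K rc 0 · 0 errors · 0 sorries; Probe rc 0 with 263 `#print axioms` guards all standard; Ctrl0 rc 0; Ctrl rc 1 with exactly the 46 planted errors; tokens: sorry / native_decide / private / instance / set_option / structure / fact-def all 0, `SiegelClause` only in conclusion position); LABEL OF RECORD: literature KNOWN TOOL (Siegel 1929 genus one / AEC IX.3.2.2 base change) · problem-relative NEW LEVER on the K-line (first global finiteness theorem; first PROVED binder-class input, `SiegelClause` discharged on an infinite certified-territory class); TALLY lens-1 ×19 + THEOREM ×21; RULE K-R53 FIXED verbatim as pre-announced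 L2834 ((i) toolkit ∪= Siegel transfer in general, ×0-as-record; (ii) open territory at m₀ = 2 := K-R52 territory ∧ live at every place incl. ℝ ∧ genus ≥ 2 not transfer-reachable, standing witness W4; (iii) payable: uniform ThinFibre 2 / a binder proved / W4 itself / a genus-≥2 territory class by a new lever / the genus-one grade uniformly — ask first; (iv) unconditional part ∪= {P : a Siegel transfer datum is typed} — today SW e, dQ e ≠ 0); lens DONE L2865; PORT GO L2866 exactly as census STAGING NOTE 12 L2863 (five parts, the Family split accepted). Port by census-1 gen 23 as `RootDecomp1KSiegelGenusOne01–05` (`--supports stmt-Schanuel-33364`; no census credit): 01 = §A the genus-one model over a field with t⁴ = 17 (Taylor data, `cW`, the point `(XE, YE)`, `equation_XE_YE`, `c₄`/`c₆`/`Δ ≠ 0`, recovery of r; section Algebra); 02 = §B valuation bounds, the max trick `val_le_one_of_eigen`, the `X_E`-stable lattice and its matrix (sections Valuation, Lattice) and §C the number field ℚ(θ), Siegel's theorem assembled inline from the three proved Literature theorems, `finite_ordinates_dyadic` / `finite_abscissae_dyadic` / finiteness of level ordinates and abscissae (section Finiteness); 03 = §D part 1: the class `SW e`, `levelFinite_SW`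 / `thinFibreAt_SW` / `bddLevelEmpty_SW` / `siegelClause_SW` for every e with `dQ e ≠ 0`, the real place (dead side / live side), up to `not_rootlessTop_SW` (section Family, first half); 04 = §D part 2: the refusals `not_decidedAt_two_SW` / `not_localAt_SW` / `not_gaussAt_SW` / …, the pinned family `sX' j = 21505j + 937`, `sE'`, `S'`, `dQ_sE'_ne_zero` uniformly, `levelFinite_S'` / `thinFibreAt_S'` / `S'_real_live`, the decided member SW(−342), the filed (withdrawn) family S j (section Family, second half — re-opened with K's own open-lines); 05 = §E TERRITORY: Δ_x(SW e) 17-Eisenstein ⇒ irreducible quartic, the resolvent certificate mod 11, `S'_territory` by tree names (section Territory). PORT EDITS: no docstring added (K documents every declaration); EIGHT one-line valuation helpers of §B PRIVATISED (`vle_add`, `vle_sub`, `vle_neg`, `vle_intCast`, `vle_natCast`, `vle_pow`, `vle_mul`, `vle_ofNat` — gate-forced: p846698 bounced `dedup.landed`, they restate `WeierstrassCurve.Affine.Point.abv_*_le_one` [Literature/NumberTheory/EllipticCurves/NeronLocalHeightGoodPlaces] and `Literature.NumberTheory.LFunctions.valuation_{int,nat}Cast_le_one`; statements and proofs kept verbatim,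 `private` added, private copies carried into later parts where used); no re-pointing, no import change, no set_option; the only structural edit is the split of `section Family` at the declaration boundary before `not_decidedAt_two_SW` (part 03 closes it with an inserted `end Family`, part 04 re-opens it with K's own 20 `open` lines ll. 661–680 verbatim; no `variable` lives in that section); provenance doc blocks + continuation headers (`noncomputable section`, `namespace`, `open Polynomial`, `open scoped Classical`) = K's own; statements and proofs VERBATIM. Rung 0 — nothing here proves Schanuel, 33364, 33363, 31077 or ThinFibre 2; everything HYPOTHESIS-FREE (the Literature inputs are proved theorems).)
-/

noncomputable section

namespace Summit.Schanuel.Schanuel.Theorems.RootDecomp1KSiegelGenusOne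

open Polynomial
open scoped Classical

/-! ### §D  THE CLASS `SW e := (Y⁴ − 17)·x² + (Y² + 17Y − 17)·x + e`, ITS LEVEL FINITENESS FOR EVERY `e` WITH
`dQ e ≠ 0`, THE REAL PLACE (dead side / live side), AND THE REPAIRED INFINITE FAMILY `S' j := SW (−64X_j² − 43X_j)`,
`X_j := 21505j + 937` (smooth anchor point `(X_j, 3)`, every level real-live); the FILED family `S j` (real-dead, `j ≥ 1`) last -/

section Family

open LiouvilleNumber
open scoped Nat
open Summit.Schanuel.Schanuel.Theorems.RootDecomp1KTwoBaseCell (psNumer partialSum_eq_psNumer_div coprime_psNumer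
  partialSum_pos' partialSum_lt_two)
open Summit.Schanuel.Schanuel.Theorems.RootDecomp1KDegreeLadder
open Summit.Schanuel.Schanuel.Theorems.RootDecomp1KXLinear
open Summit.Schanuel.Schanuel.Theorems.RootDecomp1KXLinearII
open Summit.Schanuel.Schanuel.Theorems.RootDecomp1KXTop
open Summit.Schanuel.Schanuel.Theorems.RootDecomp1KXAll
open Summit.Schanuel.Schanuel.Theorems.RootDecomp1KLevelFinite
open Summit.Schanuel.Schanuel.Theorems.RootDecomp1KThueMahler
open Summit.Schanuel.Schanuel.Theorems.RootDecomp1KParamThueMahler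
open Summit.Schanuel.Schanuel.Theorems.RootDecomp1KLocalExponent
open Summit.Schanuel.Schanuel.Theorems.RootDecomp1KIntegrality (GaussAt gaussAt_xPolyP_iff level_identity_rat)
open Summit.Schanuel.Schanuel.Theorems.RootDecomp1KSubspaceBranch (SepTopAt)
open Summit.Schanuel.Schanuel.Theorems.RootDecomp1KHeightGrading (BddLevelEmpty bddLevelEmpty_iff_levelFinite)
open Summit.Schanuel.Schanuel.Theorems.RootDecomp1KRunge
open Summit.Schanuel.Schanuel.Theorems.RootDecomp1KDescent
open Summit.Schanuel.Schanuel.Theorems.RootDecomp1KCubicDescent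
open Summit.Schanuel.Schanuel.Theorems.RootDecomp1KOddEmpty

/-- [datum] the `x¹`-coefficient `G := Y² + 17Y − 17` (its constant `−17 ≠ 0` and odd part `17Y` are what keep the
class out of the `x ↦ −x` and `Y ↦ −Y` quotient costumes). -/
def sG : ℤ[X] := X ^ 2 + C 17 * X - C 17
/-- [datum] the `x`-coefficients of `SW e`: `c₂ = Q = Y⁴ − 17` (W4's top), `c₁ = G`, `c₀ = e`. -/
def sC (e : ℤ) : ℕ → ℤ[X] := fun j => if j = 2 then vQ else if j = 1 then sG else if j = 0 then C e else 0
/-- [datum] **`SW e := (Y⁴ − 17)·x² + (Y² + 17Y − 17)·x + e`**. -/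
def SW (e : ℤ) : ℤ[X][X] := xPolyP 2 (sC e)
/-- [datum] `X_j := 21505j + 937` (`21505 = 5·11·17·23` freezes the residues the certificates read: `X_j ≡ 2 (mod 935)`,
`X_j ≡ 17 (mod 23)` — the PIN of crit L2849; REPAIRED class, bus REPAIR L2845). -/
def sX' (j : ℕ) : ℤ := 21505 * j + 937
/-- [datum] `e′_j := −64·X_j² − 43·X_j` (so that `(X_j, 3)` is a SMOOTH point of `SW e′_j`, `c₂(3) = 64 > 0`, and
`e′_j ↓ −∞` keeps every level REAL-LIVE; `e′₀ = −56 230 307`, `e′₁ = −32 234 140 302`). -/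
def sE' (j : ℕ) : ℤ := -64 * sX' j ^ 2 - 43 * sX' j
/-- [datum] **THE REPAIRED FAMILY `S' j := SW e′_j`** (bus REPAIR line; CLAIM L2826 as repaired after PRICE L2834). -/
def S' (j : ℕ) : ℤ[X][X] := SW (sE' j)

/-- `(e : ℤ) : sC e 2 = vQ`. -/
@[simp] theorem sC_two (e : ℤ) : sC e 2 = vQ := by simp [sC]
/-- `(e : ℤ) : sC e 1 = sG`. -/
@[simp] theorem sC_one (e : ℤ) : sC e 1 = sG := by simp [sC]
/-- `(e : ℤ) : sC e 0 = C e`. -/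
@[simp] theorem sC_zero (e : ℤ) : sC e 0 = C e := by simp [sC]
/-- `(e : ℤ) {j : ℕ} (hj : 2 < j) : sC e j = 0`. -/
theorem sC_of_gt (e : ℤ) {j : ℕ} (hj : 2 < j) : sC e j = 0 := by
  simp [sC, show j ≠ 2 by omega, show j ≠ 1 by omega, show j ≠ 0 by omega]
/-- `{R : Type*} [CommRing R] [Algebra ℤ R] (y : R) : aeval y sG = y ^ 2 + 17 * y - 17`. -/
@[simp] theorem aeval_sG {R : Type*} [CommRing R] [Algebra ℤ R] (y : R) : aeval y sG = y ^ 2 + 17 * y - 17 := by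
  simp [sG, map_ofNat]

/-- `SW e` evaluated: `x²·(y⁴ − 17) + x·(y² + 17y − 17) + e`. -/
theorem bev_SW (e : ℤ) (x y : ℝ) : bev (SW e) x y = x ^ 2 * (y ^ 4 - 17) + x * (y ^ 2 + 17 * y - 17) + e := by
  rw [SW, bev_xPolyP]
  simp [Finset.sum_range_succ]
  ring
/-- the evaluation IS `pS` of §A (over `ℝ`). -/
theorem bev_SW_eq_pS (e : ℤ) (x y : ℝ) : bev (SW e) x y = pS (e : ℝ) x y := by rw [bev_SW, pS]; ring
/-- a RATIONAL point in the tree's `bev` language IS a zero of `pS` over `ℚ`. -/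
theorem pS_eq_zero_of_bev (e : ℤ) (ξ ρ : ℚ) (h : bev (SW e) ξ ρ = 0) : pS (e : ℚ) ξ ρ = 0 := by
  rw [bev_SW_eq_pS] at h
  have h' : ((pS (e : ℚ) ξ ρ : ℚ) : ℝ) = 0 := by rw [← h]; push_cast [pS]; ring
  exact_mod_cast h'

/-- **THE REAL PLACE, DEAD SIDE** (crit PRICE L2834 (C), the degeneracy that killed the filed class): for `0 < x ≤ 2`
and every real `y`, `SW e (x, y) ≥ e − 17x² − (357/4)x ≥ e − 246.5`; so for `247 ≤ e` the curve `SW e` has NO REAL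
POINT with abscissa in `(0, 2]` — in particular none over any level `s_N`. -/
theorem bev_SW_pos (e : ℤ) (he : 247 ≤ e) {x : ℝ} (hx0 : 0 < x) (hx2 : x ≤ 2) (y : ℝ) : 0 < bev (SW e) x y := by
  rw [bev_SW]
  have he' : (247 : ℝ) ≤ e := by exact_mod_cast he
  nlinarith [mul_nonneg hx0.le (sq_nonneg (y + 17 / 2)), sq_nonneg (x * y ^ 2),
    mul_nonneg (sub_nonneg.mpr hx2) hx0.le]
/-- **THE REAL PLACE, LIVE SIDE**: for `e ≤ 0` and `1/2 ≤ x` the curve `SW e` HAS a real point with abscissa `x`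
(`P(x, 0) = e − 17x² − 17x < 0 < P(x, 17 − 4e)`, intermediate value theorem). -/
theorem exists_real_root_SW (e : ℤ) (he : e ≤ 0) {x : ℝ} (hx : 1 / 2 ≤ x) : ∃ y : ℝ, bev (SW e) x y = 0 := by
  have he' : (e : ℝ) ≤ 0 := by exact_mod_cast he
  let f : ℝ → ℝ := fun y => x ^ 2 * (y ^ 4 - 17) + x * (y ^ 2 + 17 * y - 17) + e
  have hcont : Continuous f := by fun_prop
  have h0 : f 0 ≤ 0 := by
    show x ^ 2 * ((0 : ℝ) ^ 4 - 17) + x * ((0 : ℝ) ^ 2 + 17 * 0 - 17) + e ≤ 0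
    nlinarith
  have hY : (0 : ℝ) ≤ 17 - 4 * e := by linarith
  have h1 : 0 ≤ f (17 - 4 * e) := by
    show 0 ≤ x ^ 2 * ((17 - 4 * (e : ℝ)) ^ 4 - 17) + x * ((17 - 4 * (e : ℝ)) ^ 2 + 17 * (17 - 4 * e) - 17) + e
    have h3 : (17 : ℝ) ≤ 17 - 4 * e := by linarith
    have h4 : (17 : ℝ) ^ 3 ≤ (17 - 4 * e) ^ 3 := by gcongr
    have h5 : (17 : ℝ) ^ 3 * (17 - 4 * e) ≤ (17 - 4 * e) ^ 4 := by
      rw [show ((17 : ℝ) - 4 * e) ^ 4 = (17 - 4 * e) ^ 3 * (17 - 4 * e) from by ring]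
      exact mul_le_mul_of_nonneg_right h4 hY
    have hx2 : (1 : ℝ) / 4 ≤ x ^ 2 := by nlinarith
    have hA : 0 ≤ x * ((17 - 4 * (e : ℝ)) ^ 2 + 17 * (17 - 4 * e) - 17) := mul_nonneg (by linarith) (by nlinarith)
    have h6 : (0 : ℝ) ≤ (17 - 4 * e) ^ 4 - 17 := by nlinarith
    have h7 : 1 / 4 * ((17 - 4 * (e : ℝ)) ^ 4 - 17) ≤ x ^ 2 * ((17 - 4 * e) ^ 4 - 17) :=
      mul_le_mul_of_nonneg_right hx2 h6
    nlinarith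
  obtain ⟨y, -, hy⟩ := intermediate_value_Icc hY hcont.continuousOn (Set.mem_Icc.mpr ⟨h0, h1⟩)
  exact ⟨y, by rw [bev_SW]; exact hy⟩
/-- the `x`-PARTIAL of `SW e` at a real point, typed `HasDerivAt`: `∂P/∂x (x, y) = 2x(y⁴ − 17) + (y² + 17y − 17)`. -/
theorem hasDerivAt_bev_SW (e : ℤ) (x y : ℝ) :
    HasDerivAt (fun x' => bev (SW e) x' y) (2 * x * (y ^ 4 - 17) + (y ^ 2 + 17 * y - 17)) x := by
  have h : (fun x' => bev (SW e) x' y) = fun x' => (y ^ 4 - 17) * x' ^ 2 + (y ^ 2 + 17 * y - 17) * x' + e := by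
    funext x'; rw [bev_SW]; ring
  rw [h]
  have hp : HasDerivAt (fun x' : ℝ => x' ^ 2) (2 * x) x := by simpa using hasDerivAt_pow 2 x
  have h1 : HasDerivAt (fun x' : ℝ => (y ^ 4 - 17) * x' ^ 2 + (y ^ 2 + 17 * y - 17) * x' + (e : ℝ))
      ((y ^ 4 - 17) * (2 * x) + (y ^ 2 + 17 * y - 17) * 1) x :=
    ((hp.const_mul _).add ((hasDerivAt_id' x).const_mul _)).add_const _
  exact h1.congr_deriv (by ring)

/-- `: sG.natDegree = 2`. -/
theorem natDegree_sG : sG.natDegree = 2 := by unfold sG; compute_degree!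
/-- `: sG.coeff 0 = -17`. -/
theorem coeff_sG_zero : sG.coeff 0 = -17 := by
  rw [sG]; simp only [coeff_add, coeff_sub, coeff_X_pow, coeff_C_mul_X, coeff_C]; norm_num
/-- `: sG.coeff 3 = 0`. -/
theorem coeff_sG_three : sG.coeff 3 = 0 := by
  rw [sG]; simp only [coeff_add, coeff_sub, coeff_X_pow, coeff_C_mul_X, coeff_C]; norm_num
/-- `(e : ℤ) (i : ℕ) : xCoeff (SW e) i = sC e i`. -/
theorem xCoeff_SW (e : ℤ) (i : ℕ) : xCoeff (SW e) i = sC e i := by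
  rw [SW, xCoeff_xPolyP]
  split_ifs with h
  · rfl
  · exact (sC_of_gt _ (by omega)).symm
/-- `(e : ℤ) : sC e 2 ≠ 0`. -/
theorem sC_two_ne_zero (e : ℤ) : sC e 2 ≠ 0 := by rw [sC_two]; exact vQ_ne_zero
/-- `(e : ℤ) : xdeg (SW e) = 2`. -/
theorem xdeg_SW (e : ℤ) : xdeg (SW e) = 2 := by rw [SW]; exact xdeg_xPolyP 2 _ (sC_two_ne_zero e)
/-- `(e : ℤ) : topX (SW e) = vQ` — W4's top. -/
theorem topX_SW (e : ℤ) : topX (SW e) = vQ := by rw [SW, topX_xPolyP 2 _ (sC_two_ne_zero e), sC_two]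
/-- `(e : ℤ) : 4 ≤ (SW e).natDegree`. -/
theorem four_le_natDegree_SW (e : ℤ) : 4 ≤ (SW e).natDegree := by
  refine le_natDegree_of_ne_zero fun h => ?_
  have h1 := congrArg (fun q : ℤ[X] => q.coeff 2) h
  simp only [SW, coeff_coeff_xPolyP, coeff_zero] at h1
  rw [if_pos (by simp), sC_two, coeff_vQ_four] at h1
  exact one_ne_zero h1
/-- `(e : ℤ) : (SW e).natDegree = 4`. -/
theorem natDegree_SW (e : ℤ) : (SW e).natDegree = 4 := by
  refine le_antisymm ?_ (four_le_natDegree_SW e)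
  rw [SW]
  refine natDegree_xPolyP_le 2 _ 4 fun i hi => ?_
  interval_cases i
  · rw [sC_zero]; exact (natDegree_C _).le.trans (Nat.zero_le _)
  · rw [sC_one, natDegree_sG]; norm_num
  · rw [sC_two, RootDecomp1KOddEmpty.natDegree_vQ]
/-- `(e : ℤ) : SW e ≠ 0`. -/
theorem SW_ne_zero (e : ℤ) : SW e ≠ 0 := fun h => by
  have := four_le_natDegree_SW e; rw [h, natDegree_zero] at this; omega
/-- `(e : ℤ) : eTop (SW e) = 0` — FULL-DEGREE top. -/
theorem eTop_SW (e : ℤ) : eTop (SW e) = 0 := by rw [eTop, natDegree_SW, topX_SW, RootDecomp1KOddEmpty.natDegree_vQ]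
/-- `(e : ℤ) : (topX (SW e)).natDegree = (SW e).natDegree`. -/
theorem natDegree_topX_SW (e : ℤ) : (topX (SW e)).natDegree = (SW e).natDegree := by
  rw [topX_SW, RootDecomp1KOddEmpty.natDegree_vQ, natDegree_SW]
/-- `(e : ℤ) : ¬ (SW e).natDegree < 2 * xdeg (SW e)` — OUTSIDE node 12's height shape. -/
theorem not_natDegree_SW_lt (e : ℤ) : ¬ (SW e).natDegree < 2 * xdeg (SW e) := by
  rw [natDegree_SW, xdeg_SW]; norm_num

/-- [datum] RATE-1 BEZOUT certificate (generator `g61/py`): `bzA·Q + bzB·G = 98821 = 17·5813 = Res_Y(Q, G)`. -/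
def sBzA : ℤ[X] := C (-5796) + C (-323) * X
/-- `: ℤ[X]`. -/
def sBzB : ℤ[X] := C (-17) + C 306 * X + C 305 * X ^ 2 + C 323 * X ^ 3
/-- `: sBzA * vQ + sBzB * sG = C 98821`. -/
theorem bezout_s : sBzA * vQ + sBzB * sG = C 98821 := by
  simp only [sBzA, sBzB, vQ, sG, map_neg, map_ofNat]
  ring
/-- RATE 1, TYPED: at every root `β` of the top `Q` the `x¹`-coefficient `G` does not vanish (Bezout). -/
theorem aeval_xCoeff_one_ne_zero_of_root_SW (e : ℤ) (K : Type) [Field K] [CharZero K] (β : K)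
    (hβ : aeval β (topX (SW e)) = 0) : aeval β (xCoeff (SW e) 1) ≠ 0 := by
  rw [topX_SW] at hβ
  rw [xCoeff_SW, sC_one]
  intro h1
  have h := congrArg (aeval β) bezout_s
  rw [map_add, map_mul, map_mul, hβ, h1, mul_zero, mul_zero, add_zero, aeval_C, eq_intCast] at h
  exact Int.cast_ne_zero.mpr (by norm_num : (98821 : ℤ) ≠ 0) h.symm

/-- `SW e` has NO x-linear presentation (second `x`-difference of `P(x, 0) = −17x² − 17x + e` is `−34 ≠ 0`). -/
theorem SW_ne_xLinP (e : ℤ) (A B : ℤ[X]) : SW e ≠ xLinP A B := by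
  intro hP
  have h := fun x : ℝ => congrArg (fun Q => bev Q x 0) hP
  have h0 := h 0
  have h1 := h 1
  have h2 := h 2
  simp only [bev_SW, bev_xLinP] at h0 h1 h2
  have : (-34 : ℝ) = 0 := by linear_combination h0 - 2 * h1 + h2
  norm_num at this
/-- `(e : ℤ) : ¬ XLinearLt (SW e)`. -/
theorem not_xLinearLt_SW (e : ℤ) : ¬ XLinearLt (SW e) := fun ⟨A, B, _, _, hP⟩ => SW_ne_xLinP e A B hP
/-- outside node 16's record class (x-linear by statement). -/
theorem not_xLinTM_SW (e : ℤ) : ¬ XLinTM (SW e) := fun ⟨A, B, _, _, _, _, hP⟩ => SW_ne_xLinP e A B hP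
/-- not a conjugate-poles norm shape of node 10. -/
theorem SW_ne_normShapeCurve (e : ℤ) (g q : ℤ[X]) (n : ℕ) (D : ℤ) : SW e ≠ normShapeCurve g q n D := by
  rw [normShapeCurve_eq_xLinP]; exact SW_ne_xLinP e _ _
/-- not a two-term curve `x^k·B(Y) − A(Y)` (the `x`-support is `{0, 1, 2}`: `c₂(0) = c₁(0) = −17 ≠ 0`). -/
theorem SW_ne_twoTermP (e : ℤ) (k : ℕ) (B A : ℤ[X]) : SW e ≠ twoTermP k B A := by
  intro h
  have hc : ∀ i i' : ℕ, (if i' ∈ Finset.range 3 then (sC e i').coeff i else 0) =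
      ((if i' = k then B.coeff i else 0) - (if i' = 0 then A.coeff i else 0)) := by
    intro i i'
    rw [← coeff_coeff_xPolyP, ← coeff_coeff_twoTermP, ← h]; rfl
  by_cases hk : k = 1
  · subst hk
    have h02 := hc 0 2
    rw [if_pos (by simp), if_neg (by norm_num), if_neg (by norm_num), sC_two, coeff_vQ_zero] at h02
    omega
  · have h01 := hc 0 1
    rw [if_pos (by simp), if_neg (fun h => hk h.symm), if_neg (by norm_num), sC_one, coeff_sG_zero] at h01
    omega
/-- in EVERY presentation `SW e = Σ_{i ≤ k} x^i c_i(Y)` the top has a `ℚ₂`-root (it is `Q` or `0`). -/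
theorem exists_padic_root_top_of_SW_eq (e : ℤ) (k : ℕ) (c : ℕ → ℤ[X]) (h : SW e = xPolyP k c) :
    ∃ z : ℚ_[2], aeval z (c k) = 0 := by
  by_cases hck : c k = 0
  · exact ⟨0, by rw [hck, map_zero]⟩
  · have h1 := topX_SW e
    rw [h, topX_xPolyP k c hck] at h1
    rw [h1]; exact exists_padic_root_vQ
/-- `(e : ℤ) (n : ℕ) : ¬ RootlessTop n (SW e)`. -/
theorem not_rootlessTop_SW (e : ℤ) (n : ℕ) : ¬ RootlessTop n (SW e) := by
  rintro ⟨k, c, -, hroot, h⟩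
  obtain ⟨z, hz⟩ := exists_padic_root_top_of_SW_eq e k c h
  exact hroot z hz

end Family

end Summit.Schanuel.Schanuel.Theorems.RootDecomp1KSiegelGenusOne

end
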